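import Summits.QuantumFields.YangMills.Theorems.LangevinControlUVOSLegsFromFemtoAndGapDefs
import Literature.MathematicalPhysics.QuantumFieldTheory.Balaban1983to89.T4Continuum
import HarnessLib

/-!
# Route `BalabanLadder`, junction `UV → UVSeamRec → … → YangMills`: the Y2 ceilings and lattice-gap legs ON A CLASS OF RAW TORUS SIDES — vocabulary

Route-posited objects (D-0016 `<Route><Crux>Defs` pattern; no `Theses` decl is restated) for the route owner's RULING of record on the
«torus parity» junction (ym-beyond-p2 g20, 2026-08-26T18:17:23Z, `pub/ym-beyond/p2-g20-files/ruling_torus_parity_g20.md` 310621248c29b33b =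
evidence #32 on stmt-QuantumFields-20043, #9 on 19351): «ADOPTED DIRECTION (c′): the honest junction currency is CLASS-parametric —
`LowerBoundsOn ∕ MomentBounds6On ∕ GapInUnitsOn G r a 𝓣`, `𝓣` an unbounded class of RAW sides (even allowed), ∃-produced by the UV side
(`𝓣_A = {2·L^n}`), ∀-consumed by IR∕ROT».  This file TYPES two of the three class-parametric legs over RAW torus sides `M ∈ 𝓣`
(`(ℤ/Mℤ)⁴`, any parity) — the ceilings `MomentBounds6OnSides` and the lattice gap `GapInUnitsOnSides` — together with the raw-torus expectation
`torusEOn` and Track A's side class `familySides = {(F.P K).sitesPerDir 0} = {2·L^{m+K}}`.  The names carry `OnSides` because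
`InfiniteVolume.MomentBounds6On ∕ LowerBoundsOn` (R136 (i), classes of infinite-volume STATES) and `ROT.LatticeRotWardOn ∕ UnboundedClass`
(classes of torus HALF-sides `L`, torus `2L+1`) already exist with other index types.  The kernels file
`Theorems/BalabanLadderUVTorusClass.lean` certifies the two specialisations that make this a junction currency and not a twin (D-0061):
at the class of ODD sides the new predicates are the spine's literal legs (`momentBounds6OnSides_odd_iff : … {M | Odd M} ↔ MomentBounds6 G r a`,
`gapInUnitsOnSides_odd_iff`), and on `familySides` the raw-torus expectation IS Bałaban's `Missing.expect (F.P K) (N·β)` (Track A's symbols).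
NOT typed here: `LowerBoundsOnSides` (the floors smear over the symmetric box `box 4 L ↔ ℤ/(2L+1)`; a raw side needs a fundamental-domain box
first — left to KNIT 5 proper).  NOTHING is asserted; whether any route item is re-typed over these names is the owner's ∕ operator's decision
(KNIT 5 scope memo `pub/ym-fleet/ym-osasm-p1/KNIT5-SCOPE.md`: the summit statement's own `SpeciesScheme.side = 2L+1` is part of the seam).

HONEST FRAMING: conditional-chain bookkeeping (0∕6 legs); the predicates are OWED exactly as `MomentBounds6`/`GapInUnits` are; not a gap, not Clay.
Refs: T. Bałaban, CMP 109 (1987) 249, (0.1) p. 251; K. Osterwalder, E. Seiler, Ann. Phys. 110 (1978) 440 §2; A. Jaffe, E. Witten (2006) §5.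
-/

set_option autoImplicit false

noncomputable section

open MeasureTheory Filter Topology
open Literature.MathematicalPhysics.QuantumFieldTheory
open Literature.MathematicalPhysics.QuantumFieldTheory.Balaban1983to89
open Literature.MathematicalPhysics.QuantumFieldTheory.Balaban1983to89.T4Continuum
open Literature.MathematicalPhysics.QuantumLattice (LGConfig torusLift configShift)
open Summit.QuantumFields.YangMills.Cruxes.OSLegsFromFemtoAndGap.DlrCollarTransfer (plane)

namespace Summit.QuantumFields.YangMills.Cruxes.UV.TorusClass

section Legs

variable (G : Type) [Group G] [TopologicalSpace G] [IsTopologicalGroup G] [CompactSpace G]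
  [MeasurableSpace G] [BorelSpace G] (r : LatticeRep G) (a : ℝ → ℝ)

/-- **Expectation on the raw torus `(ℤ/Mℤ)⁴`** of an observable of `ℤ⁴` gauge fields, read on the periodic lift of the Wilson state in the
representation `r` at inverse coupling `β`: `∫ Φ (torusLift M V) dμ_{M,β}(V)`.  `DlrCollarTransfer.torusE G r β S` is the case `M = 2S+1`
(definitionally). -/
def torusEOn (β : ℝ) (M : ℕ) [NeZero M] (Φ : LGConfig 4 G → ℝ) : ℝ :=
  ∫ V, Φ (torusLift M V) ∂(wilsonMeasure (d := 4) (L := M) r.ρ β)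

/-- **`MomentBounds6OnSides G r a 𝓣` — the plane-resolved E0′ ceilings on the tori whose RAW side lies in the class `𝓣 ⊆ ℕ`.**  There are
`C ≥ 0`, `β₄`, `ℓ₄ > 0` such that for all `β ≥ β₄`, every side `M ∈ 𝓣`, every string of orientations `(q i).1 < (q i).2` at sites `x i ∈ ℤ⁴`
and every collar radius `R ≥ 1` with `R·a(β) ≤ ℓ₄`, `8R+16 ≤ M` (= the half-side clause `4R+8 ≤ S` of `MomentBounds6` when `M = 2S+1`,
`4R+8 ≤ M/2` when `M` is even) and pairwise cyclic sup-separation `2R+4 ≤ |(x i k − x j k) mod M|` in some coordinate, the centred mixed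
moment of the single-plane fields under the Wilson state on `(ℤ/Mℤ)⁴` is at most `(C/R⁴)ⁿ`.  VERBATIM `DlrCollarTransfer.MomentBounds6` with
`2S+1 ↦ M ∈ 𝓣`; at `𝓣 = {M | Odd M}` it IS `MomentBounds6 G r a` (`TorusClass.momentBounds6OnSides_odd_iff`).  OWED (E0′); never asserted. -/
def MomentBounds6OnSides (𝓣 : Set ℕ) : Prop :=
  ∃ (C β₄ ℓ₄ : ℝ), 0 < ℓ₄ ∧ 0 ≤ C ∧ ∀ β : ℝ, β₄ ≤ β →
    ∀ (M : ℕ) [NeZero M], M ∈ 𝓣 →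
      ∀ (n : ℕ) (q : Fin n → Fin 4 × Fin 4) (x : Fin n → (Fin 4 → ℤ)) (R : ℕ), (∀ i, (q i).1 < (q i).2) →
        1 ≤ R → (R : ℝ) * a β ≤ ℓ₄ → 8 * R + 16 ≤ M →
        (∀ i j : Fin n, i ≠ j → ∃ k : Fin 4,
          (2 * (R : ℤ) + 4) ≤ |((((x i k - x j k : ℤ) : ZMod M)).valMinAbs : ℤ)|) →
        |torusEOn G r β M (fun U => ∏ i, (plane G r (q i) (x i) U - torusEOn G r β M (plane G r (q i) (x i))))| ≤
          (C / (R : ℝ) ^ 4) ^ n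

/-- **`GapInUnitsOnSides G r a 𝓣` — the volume-uniform lattice mass gap in units `a` on the tori whose RAW side lies in `𝓣`.**  There are
`c₁ > 0`, `β₂` and a side threshold `M₁(β)` such that for every pair of gauge-invariant local observables `A, B` one constant `C` bounds
`|⟨A · τ_n B⟩_{M,β} − ⟨A⟩⟨B⟩| ≤ C·exp(−c₁ a(β) n)` on every torus `(ℤ/Mℤ)⁴` with `M ∈ 𝓣`, `M ≥ M₁(β)`, for `β ≥ β₂` and all time separations
`2n+1 ≤ M`.  VERBATIM `DlrCollarTransfer.GapInUnits` (`latticeConnectedCorr … (2S+1) …`, `S₁ β ≤ S`, `n ≤ S`) with `2S+1 ↦ M ∈ 𝓣`; at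
`𝓣 = {M | Odd M}` it IS `GapInUnits G r a` (`TorusClass.gapInUnitsOnSides_odd_iff`).  OWED (the infrared leg); never asserted. -/
def GapInUnitsOnSides (𝓣 : Set ℕ) : Prop :=
  ∃ (c₁ β₂ : ℝ) (M₁ : ℝ → ℕ), 0 < c₁ ∧ ∀ A B : YMSpecies G, ∃ C : ℝ, ∀ β : ℝ, β₂ ≤ β →
    ∀ (M : ℕ) [NeZero M], M ∈ 𝓣 → M₁ β ≤ M → ∀ n : ℕ, 2 * n + 1 ≤ M →
      |latticeConnectedCorr r.ρ β M A.F B.F n| ≤ C * Real.exp (-(c₁ * a β * n))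

end Legs

/-- **Track A's side class `𝓣_A`**: the raw sides of the finest lattices of the four-torus families, `(F.P K).sitesPerDir 0 = 2·L^{m+K}`
(`L` odd `> 11`, `m ≥ 1`, `K ≥ 0`) — all EVEN, unbounded, disjoint from the odd class (kernels file §3). [cite: Balaban1987RG1, (0.1) p.251] -/
def familySides : Set ℕ :=
  {M | ∃ (F : T4Family) (K : ℕ), M = (F.P K).sitesPerDir 0}

end Summit.QuantumFields.YangMills.Cruxes.UV.TorusClass

end
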